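import Literature.NumberTheory.DiophantineGeometry.KroneckerSemigroup
import Literature.Computability.Complexity.OccurrenceObstructionsIPProofs
import HarnessLib

/-!
# Ikenmeyer–Panova 2017: the semigroup property discharged; IP Lemma 4.2 from the square
# positivity alone

Sibling proofs file (D-0014) of `Literature/Computability/Complexity/OccurrenceObstructionsIP.lean`.
Theorems only.

1. **`ikenmeyerPanova2017_semigroup_holds`** discharges the named fact
   `Literature.Computability.Complexity.ikenmeyerPanova2017_semigroup` (C. Ikenmeyer, G. Panova,
   Adv. Math. 319 (2017), §1.1, the semigroup property of the Kronecker coefficients: "If for 6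
   partitions `λ, μ, ν, λ', μ', ν'` … `g(λ, μ, ν) > 0` and `g(λ', μ', ν') > 0`, then also
   `g(λ+λ', μ+μ', ν+ν') > 0`", for triples of possibly different sizes, row-wise sums
   `Nat.Partition.rowAdd`) by the highest-weight-vector proof of
   `Literature/NumberTheory/DiophantineGeometry/KroneckerSemigroup.lean`
   (`kroneckerCoeff_pos_of_ofPartition_add`: `g(λ, μ, ν)` is the dimension of the `S_a`-invariant
   triple tensors with partial functions in `HW_λ, HW_μ, HW_ν`, and symmetrised concatenation
   products of such tensors are nonzero), with `N = a + b` bounding all parts and the weights of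
   the row-wise sums computed by `ofPartition_rowAdd`.
2. **Consequences**: IP Lemma 4.2 (held: Lemma 19) from the square positivity
   `g(k×k, k×k, k×k) > 0` of Bessenrodt–Behns ALONE (`ikenmeyerPanova2017_lemma_4_2_of_square_pos`);
   the unconditional building blocks "add a one-row triple" (`kroneckerCoeff_pos_rowAdd_row_holds`)
   and "`k × (ks)` rectangles from squares" (`kroneckerCoeff_rectangle_mul_pos_of_square_pos`). After
   this file IP Thm. 4.6 (main positivity), as used by `ikenmeyerPanova2017_thm_1_4`, rests on the
   square positivity, the hook base cases of Cor. 4.4/4.5 (Kronecker coefficients of `S_49`) and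
   the combinatorics of §4 (Lemma 4.1, Prop. 4.3); IP Prop. 2.8 is the other remaining fact.

## References

* C. Ikenmeyer, G. Panova, *Rectangular Kronecker coefficients and plethysms in geometric
  complexity theory*, Adv. Math. 319 (2017) 40–66 = arXiv:1512.03798, §1.1 (the semigroup
  property; held text p. 5), Lemma 4.2 (held: Lemma 19, p. 9). [key `IkenmeyerPanova2017`]
* M. Christandl, A. W. Harrow, G. Mitchison, Comm. Math. Phys. 270 (2007) 575–585 (the semigroup
  property).
-/

namespace Literature.Computability.Complexity

open Literature.NumberTheory.DiophantineGeometry (Weight kroneckerCoeff)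

/-- A partition of `n` has at most `n` parts (each part is at least `1`). Declared in Mathlib's
`Nat.Partition` namespace for dot notation (H21 convention: deliberate extension). [folklore] -/
theorem _root_.Nat.Partition.card_parts_le_size {n : ℕ} (μ : Nat.Partition n) :
    μ.parts.card ≤ n := by
  have h : (μ.parts.map fun _ => 1).sum ≤ (μ.parts.map id).sum :=
    Multiset.sum_map_le_sum_map _ _ fun a ha => μ.parts_pos ha
  rw [Multiset.map_const', Multiset.sum_replicate, smul_eq_mul, mul_one, Multiset.map_id,
    μ.parts_sum] at h
  exact h

/-- **Discharge of `ikenmeyerPanova2017_semigroup` — the semigroup property of the Kronecker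
coefficients** (Ikenmeyer–Panova, Adv. Math. 319 (2017), §1.1; Christandl–Harrow–Mitchison 2007):
for `λ, μ, ν ⊢ a` and `λ', μ', ν' ⊢ b` with `g(λ, μ, ν) > 0` and `g(λ', μ', ν') > 0`, the row-wise
sums satisfy `g(λ+λ', μ+μ', ν+ν') > 0`. From `kroneckerCoeff_pos_of_ofPartition_add`
(`KroneckerSemigroup.lean`) with `N = a + b` (every partition of `a`, `b` or `a + b` involved has
at most `a + b` parts, `Nat.Partition.card_parts_le_size`, `card_parts_rowAdd_le`) and
`ofPartition_rowAdd` (the weight of a row-wise sum is the sum of the weights).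
[cite: IkenmeyerPanova2017, §1.1 (the semigroup property; held p. 5)] -/
theorem ikenmeyerPanova2017_semigroup_holds : ikenmeyerPanova2017_semigroup := by
  intro a b lam mu nu lam' mu' nu' h h'
  have ha : ∀ ρ : Nat.Partition a, ρ.parts.card ≤ a + b := fun ρ =>
    ρ.card_parts_le_size.trans (Nat.le_add_right a b)
  have hb : ∀ ρ : Nat.Partition b, ρ.parts.card ≤ a + b := fun ρ =>
    ρ.card_parts_le_size.trans (Nat.le_add_left b a)
  have hab : ∀ (ρ : Nat.Partition a) (ρ' : Nat.Partition b), (ρ.rowAdd ρ').parts.card ≤ a + b :=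
    fun ρ ρ' => (card_parts_rowAdd_le ρ ρ').trans (max_le (ha ρ) (hb ρ'))
  exact Literature.NumberTheory.DiophantineGeometry.kroneckerCoeff_pos_of_ofPartition_add (a + b)
    (ha lam) (ha mu) (ha nu) (hb lam') (hb mu') (hb nu') (hab lam lam') (hab mu mu') (hab nu nu')
    (ofPartition_rowAdd _ lam lam') (ofPartition_rowAdd _ mu mu') (ofPartition_rowAdd _ nu nu') h h'

/-! ### Consequences: IP's building blocks with the semigroup property discharged -/

/-- **Adding a one-row triple, unconditionally**: if `g(λ, k × b, k × b) > 0` then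
`g(λ + (kM), k × (b + M), k × (b + M)) > 0` (IP's constant move in the proofs of Lemma 4.2,
Prop. 4.3, Cor. 4.4; the tree's `kroneckerCoeff_pos_rowAdd_row` fed with the proved semigroup
property). [cite: IkenmeyerPanova2017, Lemma 4.2 (proof; held: Lemma 19, p. 9)] -/
theorem kroneckerCoeff_pos_rowAdd_row_holds {k b M : ℕ} (lam : Nat.Partition (k * b))
    (h : 0 < kroneckerCoeff ℂ lam (Nat.Partition.rectangle k b) (Nat.Partition.rectangle k b))
    (mu : Nat.Partition (k * (b + M)))
    (hmu : mu.parts = (lam.rowAdd (Nat.Partition.indiscrete (k * M))).parts) :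
    0 < kroneckerCoeff ℂ mu (Nat.Partition.rectangle k (b + M)) (Nat.Partition.rectangle k (b + M)) :=
  kroneckerCoeff_pos_rowAdd_row ikenmeyerPanova2017_semigroup_holds lam h mu hmu

/-- **Squares stacked sideways from the square positivity alone**:
`g(k × (ks), k × (ks), k × (ks)) > 0` (IP, proof of Lemma 4.2), the semigroup property being a
theorem. [cite: IkenmeyerPanova2017, Lemma 4.2 (proof; held: Lemma 19, p. 9)] -/
theorem kroneckerCoeff_rectangle_mul_pos_of_square_pos (hsq : ikenmeyerPanova2017_square_pos)
    (k s : ℕ) :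
    0 < kroneckerCoeff ℂ (Nat.Partition.rectangle k (k * s)) (Nat.Partition.rectangle k (k * s))
      (Nat.Partition.rectangle k (k * s)) :=
  kroneckerCoeff_rectangle_mul_pos hsq ikenmeyerPanova2017_semigroup_holds k s

/-- **IP Lemma 4.2 (held: Lemma 19) from the square positivity of Bessenrodt–Behns ALONE**: "Let
`μ = (k × (ks))` and `a ≥ ks`, then `g(k × (ks) + (k(a-ks)), a × k, a × k) > 0`" — the printed proof
(`ikenmeyerPanova2017_lemma_4_2_of_props`) with the semigroup and transposition properties now
theorems. [cite: IkenmeyerPanova2017, Lemma 4.2 (held: Lemma 19, p. 9)] -/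
theorem ikenmeyerPanova2017_lemma_4_2_of_square_pos (hsq : ikenmeyerPanova2017_square_pos)
    {k s a : ℕ} (hks : k * s ≤ a) (mu : Nat.Partition (a * k))
    (hmu : mu.parts = ((Nat.Partition.rectangle k (k * s)).rowAdd
      (Nat.Partition.indiscrete (k * (a - k * s)))).parts) :
    0 < kroneckerCoeff ℂ mu (Nat.Partition.rectangle a k) (Nat.Partition.rectangle a k) :=
  ikenmeyerPanova2017_lemma_4_2_of_square_pos_of_semigroup hsq ikenmeyerPanova2017_semigroup_holds
    hks mu hmu

end Literature.Computability.Complexity
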